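import Literature.Geometry.Lorentzian.KlainermanSzeftel2021.Setup
import Literature.Geometry.Lorentzian.KlainermanSzeftel2021.Bootstrap

/-!
# Klainerman–Szeftel, *Kerr stability for small angular momentum*: the bridge `Setup ⟶ Bootstrap.Setting`

CITATION HEADER (lean-in-tree rule 2026-08-18). Sources as in the two imported modules: S. Klainerman, J. Szeftel, arXiv:2104.11857
(v1, 2021) = bib key `KlainermanSzeftel2021`, journal version Pure Appl. Math. Q. **19** (2023) no. 3, 791–1678 = `KlainermanSzeftel2023`
(refereed record); `TeX l.N` = lines of the arXiv TeX source. Nothing of E. Giorgi–S. Klainerman–J. Szeftel arXiv:2205.14808 is used here.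

WHAT THIS FILE IS. NOT a route, NOT a result about the Einstein equations, and it asserts NO fact of the paper. Value = CONSISTENCY of the
typed skeleton: the abstract carrier `Bootstrap.Setting` over which `…KlainermanSzeftel2021.Bootstrap` states the bootstrap architecture
of KS §3.4–3.8 (Theorems M0–M8, the set `𝒰(u_*)`, the continuity argument) is INSTANTIATED from the concrete schematic objects of
`…KlainermanSzeftel2021.Setup` (GCM admissible spacetimes, the eight regional norms of KS §3.3, the initial data layer, the displayed
left-hand sides of Theorems M0–M2), and the two front-ends are proved to agree: `inU_iff_inAleph` (membership in `𝒰(u)` of the instance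
↔ Setup's `ℵ(u)`-membership `InAleph`, KS Def. 3.7.1 l.6744–6760), `uset_eq_𝒰` (the instance's `Uset` IS Setup's `𝒰`), `baB_iff`,
`baD_iff`, `domCond_iff`, `m2Concl_iff`, `thmM2_iff` (the node `ThmM2` on the instance, unfolded to Setup's displayed quantities,
KS l.6691–6697). Device: Setup's `ℝ≥0∞`-valued norms are read in `ℝ` through `Bootstrap.trunc x = (min x 1).toReal`; since every
threshold of the architecture is `< 1` (`ε < 1`, KS l.6084), `trunc N ≤ t ↔ N ≤ ofReal t` (`Bootstrap.trunc_le_iff`) — the CAVEAT is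
that this reading is the intended one only for thresholds `t < 1`, which every consistency theorem below carries as a hypothesis.
What Setup does not model (vacuum, developments, extension-as-solutions, the opaque conclusions of Theorems M1/M2/Main, the §3.8
limit predicates) enters as the explicit record `Bridge.Inputs` — visibly opaque DATA (no `Prop` field asserting anything), never an
axiom. Every obligation field of `Bootstrap.Setting` (monotonicity / non-negativity of the norms, `ε0_pos`) is DISCHARGED by a
theorem of Setup, not assumed. Zero `sorry`; axioms ⊆ {propext, Classical.choice, Quot.sound}; tags `[folklore]` = bookkeeping,
`[cite: …]` = provenance of a transcribed display.

STATUS OF THE SOURCE / RELATION TO TREE MATERIAL: as in the headers of the two imported modules (KS is refereed; the audit cell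
`pub-kerr` types its architecture as hypotheses over data; no relation is claimed to `StabilityCauchy.lean`, `Stability.lean` or the
`Kerr*.lean` files). `Setup.Constants.toBootstrap` is declared into the sibling module's namespace on purpose (dot notation
`c.toBootstrap` on Setup's constants record; same directory).

NOT HERE: the instantiation of the node-DAG carriers of KS ch. 5–9 (they live with the DAG module) — in particular the chapter-9
PT iteration record; only the real-valued readings `ptNormOf`, `idlPTOf` of Setup's PT norms are given.
-/

noncomputable section

open scoped ENNReal

namespace Literature.Geometry.Lorentzian.KlainermanSzeftel2021

/-! ## The two constants records agree -/

namespace Setup.Constants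

variable (c : Constants)

/-- Dictionary `Setup.Constants → Bootstrap.Constants` of the two constants records:
`(init.m, init.a, kLarge, ε₀, ε, r₀, δH, δdec, δB, δstar) ↦ (m0, a0, klarge, ε0, ε, r0, δH, δdec, δB, δstar)`. [folklore] -/
def toBootstrap : Bootstrap.Constants where
  m0 := c.m₀
  a0 := c.a₀
  klarge := c.kLarge
  ε0 := c.ε₀
  ε := c.ε
  r0 := c.r₀
  δH := c.δH
  δdec := c.δdec
  δB := c.δB
  δstar := c.δstar

/-- field agreement `m0`. [folklore] -/
@[simp] theorem toBootstrap_m0 : c.toBootstrap.m0 = c.m₀ := rfl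
/-- field agreement `a0`. [folklore] -/
@[simp] theorem toBootstrap_a0 : c.toBootstrap.a0 = c.a₀ := rfl
/-- field agreement `klarge = k_large`. [folklore] -/
@[simp] theorem toBootstrap_klarge : c.toBootstrap.klarge = c.kLarge := rfl
/-- field agreement `ε0`. [folklore] -/
@[simp] theorem toBootstrap_ε0 : c.toBootstrap.ε0 = c.ε₀ := rfl
/-- field agreement `ε`. [folklore] -/
@[simp] theorem toBootstrap_ε : c.toBootstrap.ε = c.ε := rfl
/-- field agreement `r0`. [folklore] -/
@[simp] theorem toBootstrap_r0 : c.toBootstrap.r0 = c.r₀ := rfl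
/-- field agreement `δdec`. [folklore] -/
@[simp] theorem toBootstrap_δdec : c.toBootstrap.δdec = c.δdec := rfl
/-- field agreement `δstar`. [folklore] -/
@[simp] theorem toBootstrap_δstar : c.toBootstrap.δstar = c.δstar := rfl

/-- `k_small` agrees: both are `⌊k_large/2⌋ + 1` (KS l.6110). [cite: KlainermanSzeftel2021, TeX l.6110] -/
theorem toBootstrap_ksmall : c.toBootstrap.ksmall = c.kSmall := rfl

/-- Setup's exact constraints together with the schematic `≪`-regime at any threshold `K > 1` imply the strict-inequality
shadows that `Bootstrap.lean` records as `Bootstrap.Constants.Admissible` (so every theorem of `Bootstrap.lean` stated under `Admissible`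
applies to constants chosen by Setup's `Hierarchy`). [folklore] -/
theorem toBootstrap_admissible (hE : c.Exact) {K : ℝ} (hR : c.Regime K) (hK : 1 < K) :
    c.toBootstrap.Admissible := by
  have hKpos : 0 < K := lt_trans zero_lt_one hK
  have hm : 0 < c.m₀ := c.init.m_pos
  have hgap : 0 < c.m₀ - |c.a₀| := sub_pos.2 hE.subextremal
  -- `ε ≤ max ε₀ ε` and the chain `K * max ε₀ ε ≤ … ≤ 1`, `… ≤ m₀ - |a₀|`
  have hεle : c.ε ≤ max c.ε₀ c.ε := le_max_right _ _
  have hmin1 : K * max c.ε₀ c.ε ≤ 1 := by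
    refine hR.eps_small.trans ?_
    exact (min_le_right _ _).trans ((min_le_right _ _).trans (min_le_right _ _))
  have hmin2 : K * max c.ε₀ c.ε ≤ c.m₀ - |c.a₀| := by
    refine hR.eps_small.trans ?_
    exact (min_le_right _ _).trans ((min_le_right _ _).trans (min_le_left _ _))
  have hmaxnn : 0 ≤ max c.ε₀ c.ε := le_trans hE.ε_pos.le hεle
  refine
    { m0_pos := hm
      abs_a0_lt := hE.subextremal
      δH_pos := hE.δH_pos
      δdec_pos := hE.δdec_pos
      δB_pos := hE.δB_pos
      δstar_pos := hE.δstar_pos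
      two_δdec_lt_δB := hE.two_δdec_lt_δB
      r0_large := ?_
      klarge_large := ?_
      ε0_pos := hE.ε₀_pos
      ε_lt_one := ?_
      ε_lt_gap := ?_
      ε_eq := hE.ε_eq }
  · -- `max m₀ 1 < r₀` from `K * max m₀ 1 ≤ r₀`, `K > 1`
    have hpos : 0 < max c.m₀ 1 := lt_of_lt_of_le zero_lt_one (le_max_right _ _)
    have := hR.r₀_large
    show max c.m₀ 1 < c.r₀
    nlinarith
  · -- `1/δdec < kLarge` from `K ≤ δdec * kLarge`, `K > 1`
    show 1 / c.δdec < (c.kLarge : ℝ)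
    rw [div_lt_iff₀ hE.δdec_pos]
    have := hR.kLarge_large
    nlinarith
  · show c.ε < 1
    nlinarith
  · show c.ε < c.m₀ - |c.a₀|
    nlinarith

end Setup.Constants

namespace Bridge

open Setup

open Bootstrap (trunc trunc_mono trunc_nonneg)

variable (c : Constants) (M : Spacetime) (Realized : GCMAdmissible c M → Prop)

/-- The type of REALIZED GCM admissible spacetimes on the ambient carrier `M`: Setup's `GCMAdmissible c M` cut down by
the opaque physics predicate `Realized` (the cell's DIVERGENCE DV-11). This is the carrier `M` of `Bootstrap.Setting`. [folklore] -/
abbrev Sp : Type := {𝓜 : GCMAdmissible c M // Realized 𝓜}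

/-- The inputs Setup does NOT model (each is visibly opaque data, never an axiom): extension relations between
spacetimes (Thm M7/M8), the conclusions `M1Concl/M2Concl/MainConcl` of Theorems M1/M2/Main (opaque in the node files), the PT norms and
iteration predicate of ch. 9 (real-valued readings; cf. `ptNormOf`, `idlPTOf` below), and the §3.8 limit/conclusion predicates on future developments. The displayed
left-hand sides of Theorems M0, M1, M2 are NOT inputs: they are the concrete Setup terms `M0Ext, M0Int, M1Sup, M1Flux, M1A,
M2Dec, M2Flux` (Setup §13) read through `trunc`. [folklore] -/
structure Inputs where
  Extends : Sp c M Realized → Sp c M Realized → Prop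
  BuiltByM7 : Sp c M Realized → Sp c M Realized → Prop
  M1Concl : Sp c M Realized → Prop
  M2Concl : Sp c M Realized → Prop
  MainConcl : Prop
  ptNorm : Sp c M Realized → ℕ → ℝ
  idlPT : Sp c M Realized → ℕ → ℝ
  iter : Sp c M Realized → ℕ → Prop
  IsLimitOfU : FutureDevelopment c M → Prop
  Conclusions : FutureDevelopment c M → ℝ → ℝ → Prop

variable {c M Realized}

/-- `𝔑^(Sup)_k(a, m)` of a future development read in `ℝ`, for arbitrary reals `(a, m)` (junk value `1` if `m ≤ 0`,
where Setup's `KerrParams` does not exist). [folklore] -/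
def nSupInf (Y : FutureDevelopment c M) (a m : ℝ) : ℝ :=
  if h : 0 < m then trunc (Y.NSup ⟨m, a, h⟩ c.kLarge) else 1

/-- `𝔑^(Dec)_k(a, m)` of a future development read in `ℝ`. [folklore] -/
def nDecInf (Y : FutureDevelopment c M) (a m : ℝ) : ℝ :=
  if h : 0 < m then trunc (Y.NDec ⟨m, a, h⟩ c.kSmall) else 1

/-- **The `Bootstrap.Setting` of Setup.** Norms := `trunc ∘` the `ℝ≥0∞` norms of `GCMAdmissible`; their monotonicity and
non-negativity obligations are DISCHARGED (`…_mono` of Setup §9, `trunc_mono`, `trunc_nonneg`); the initial data layer norm is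
`trunc (𝓛.I k)`; the M0/M1/M2 functionals are `trunc` of Setup §13's `M0Ext, M0Int, M1Sup, M1Flux, M1A, M2Dec, M2Flux`;
`Minf := FutureDevelopment c M`. [folklore] -/
def settingOf (𝓛 : InitialDataLayer c M) (I : Inputs c M Realized) : Bootstrap.Setting c.toBootstrap where
  M := Sp c M Realized
  ustar X := X.1.uStar
  rstar X := X.1.rStar
  mass X := X.1.params.m
  angm X := X.1.params.a
  starB X k := trunc (X.1.BStar k)
  extB X k := trunc (X.1.BExt k)
  intB X k := trunc (X.1.BInt k)
  topB X k := trunc (X.1.BTop k)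
  starD X k := trunc (X.1.DStar k)
  extD X k := trunc (X.1.DExt k)
  intD X k := trunc (X.1.DInt k)
  topD X k := trunc (X.1.DTop k)
  starB_mono X := trunc_mono.comp X.1.BStar_mono
  extB_mono X := trunc_mono.comp X.1.BExt_mono
  intB_mono X := trunc_mono.comp X.1.BInt_mono
  topB_mono X := trunc_mono.comp X.1.BTop_mono
  starD_mono X := trunc_mono.comp X.1.DStar_mono
  extD_mono X := trunc_mono.comp X.1.DExt_mono
  intD_mono X := trunc_mono.comp X.1.DInt_mono
  topD_mono X := trunc_mono.comp X.1.DTop_mono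
  starB_nonneg _ _ := trunc_nonneg _
  extB_nonneg _ _ := trunc_nonneg _
  intB_nonneg _ _ := trunc_nonneg _
  topB_nonneg _ _ := trunc_nonneg _
  starD_nonneg _ _ := trunc_nonneg _
  extD_nonneg _ _ := trunc_nonneg _
  intD_nonneg _ _ := trunc_nonneg _
  topD_nonneg _ _ := trunc_nonneg _
  idl k := trunc (𝓛.I k)
  idlExt3 := trunc (𝓛.IExt 3)
  m0Ext X := trunc X.1.M0Ext
  m0Int X := trunc X.1.M0Int
  m1Sup X δe := trunc (X.1.M1Sup δe)
  m1Flux X δe := trunc (X.1.M1Flux δe)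
  m1A X δe := trunc (X.1.M1A δe)
  m2Dec X := trunc X.1.M2Dec
  m2Flux X := trunc X.1.M2Flux
  Extends := I.Extends
  BuiltByM7 := I.BuiltByM7
  ptNorm := I.ptNorm
  idlPT := I.idlPT
  iter := I.iter
  Minf := FutureDevelopment c M
  nSupInf := nSupInf
  nDecInf := nDecInf
  IsLimitOfU := I.IsLimitOfU
  Conclusions := I.Conclusions

/-! ## Consistency: the bootstrap sets of the instance are Setup's -/

section Consistency

variable (𝓛 : InitialDataLayer c M) (I : Inputs c M Realized)

/-- an `ℝ≥0∞` inequality with a real nonnegative summand moved across `ofReal` [folklore] -/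
theorem add_ofReal_le_ofReal_iff {x : ℝ≥0∞} {s t : ℝ} (hs : 0 ≤ s) (hst : s ≤ t) :
    x + ENNReal.ofReal s ≤ ENNReal.ofReal t ↔ x ≤ ENNReal.ofReal (t - s) := by
  have ht : ENNReal.ofReal t = ENNReal.ofReal (t - s) + ENNReal.ofReal s := by
    rw [← ENNReal.ofReal_add (sub_nonneg.2 hst) hs, sub_add_cancel]
  rw [ht]
  exact ENNReal.add_le_add_iff_right ENNReal.ofReal_ne_top

/-- BA-D of the instance is Setup's BA-D (needs `0 ≤ ε < 1`). [folklore] -/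
theorem baD_iff (hε0 : 0 ≤ c.ε) (hε1 : c.ε < 1) (X : Sp c M Realized) :
    Bootstrap.BA_D (settingOf 𝓛 I) X ↔ X.1.BootstrapD := by
  have lhs : Bootstrap.BA_D (settingOf 𝓛 I) X ↔
      trunc (X.1.DStar c.kSmall) + trunc (X.1.DExt c.kSmall) + trunc (X.1.DInt c.kSmall) + trunc (X.1.DTop c.kSmall)
        ≤ c.ε := Iff.rfl
  have rhs : X.1.BootstrapD ↔
      X.1.DStar c.kSmall + X.1.DExt c.kSmall + X.1.DInt c.kSmall + X.1.DTop c.kSmall ≤ ENNReal.ofReal c.ε := Iff.rfl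
  rw [lhs, rhs, Bootstrap.trunc_add_four_le_iff hε0 hε1]

/-- BA-B of the instance is Setup's BA-B (the parameter clause `|m − m₀| + |a − a₀|` is on both sides). [folklore] -/
theorem baB_iff (hε0 : 0 ≤ c.ε) (hε1 : c.ε < 1) (X : Sp c M Realized) :
    Bootstrap.BA_B (settingOf 𝓛 I) X ↔ X.1.BootstrapB := by
  set s := |X.1.params.m - c.m₀| + |X.1.params.a - c.a₀| with hs_def
  have hs : 0 ≤ s := add_nonneg (abs_nonneg _) (abs_nonneg _)
  set T := trunc (X.1.BStar c.kLarge) + trunc (X.1.BExt c.kLarge) + trunc (X.1.BInt c.kLarge)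
    + trunc (X.1.BTop c.kLarge) with hT_def
  have hT : 0 ≤ T :=
    add_nonneg (add_nonneg (add_nonneg (trunc_nonneg _) (trunc_nonneg _)) (trunc_nonneg _)) (trunc_nonneg _)
  have lhs : Bootstrap.BA_B (settingOf 𝓛 I) X ↔ T + s ≤ c.ε := by
    have e : Bootstrap.BA_B (settingOf 𝓛 I) X ↔
        trunc (X.1.BStar c.kLarge) + trunc (X.1.BExt c.kLarge) + trunc (X.1.BInt c.kLarge)
          + trunc (X.1.BTop c.kLarge) + |X.1.params.m - c.m₀| + |X.1.params.a - c.a₀| ≤ c.ε := Iff.rfl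
    rw [e, hT_def, hs_def]
    constructor <;> intro h <;> linarith
  have rhs : X.1.BootstrapB ↔
      X.1.BStar c.kLarge + X.1.BExt c.kLarge + X.1.BInt c.kLarge + X.1.BTop c.kLarge + ENNReal.ofReal s
        ≤ ENNReal.ofReal c.ε := Iff.rfl
  rw [lhs, rhs]
  by_cases hst : s ≤ c.ε
  · rw [add_ofReal_le_ofReal_iff hs hst, ← Bootstrap.trunc_add_four_le_iff (sub_nonneg.2 hst) (by linarith),
      ← hT_def]
    constructor <;> intro h <;> linarith
  · have hst' : c.ε < s := lt_of_not_ge hst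
    constructor
    · intro h; linarith
    · intro h
      have h' : ENNReal.ofReal s ≤ ENNReal.ofReal c.ε := le_trans le_add_self h
      have := (ENNReal.ofReal_le_ofReal_iff hε0).1 h'
      linarith

/-- The dominance condition of the instance is Setup's. [folklore] -/
theorem domCond_iff (X : Sp c M Realized) : Bootstrap.DomCond (settingOf 𝓛 I) X ↔ X.1.Dominance := Iff.rfl

/-- `X ∈ 𝒰(u)` in the sense of `Bootstrap.InU` ↔ `X ∈ ℵ(u)` in Setup's sense (`InAleph`). [folklore] -/
theorem inU_iff_inAleph (hε0 : 0 ≤ c.ε) (hε1 : c.ε < 1) (u : ℝ) (X : Sp c M Realized) :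
    Bootstrap.InU (settingOf 𝓛 I) u X ↔ X.1.InAleph u := by
  constructor
  · rintro ⟨h1, h2, h3, h4⟩
    exact ⟨h1, (domCond_iff 𝓛 I X).1 h2, (baB_iff 𝓛 I hε0 hε1 X).1 h3, (baD_iff 𝓛 I hε0 hε1 X).1 h4⟩
  · rintro ⟨h1, h2, h3, h4⟩
    exact ⟨h1, (domCond_iff 𝓛 I X).2 h2, (baB_iff 𝓛 I hε0 hε1 X).2 h3, (baD_iff 𝓛 I hε0 hε1 X).2 h4⟩

/-- **The set `𝒰` of the continuity argument (`Bootstrap.Uset` on the instance) IS Setup's `𝒰 c M Realized`.** [folklore] -/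
theorem uset_eq_𝒰 (hε0 : 0 ≤ c.ε) (hε1 : c.ε < 1) :
    Bootstrap.Uset (settingOf 𝓛 I) = 𝒰 c M Realized := by
  ext u
  simp only [Bootstrap.Uset, 𝒰, Set.mem_setOf_eq]
  constructor
  · rintro ⟨hu, X, hX⟩
    exact ⟨hu, X.1, X.2, (inU_iff_inAleph 𝓛 I hε0 hε1 u X).1 hX⟩
  · rintro ⟨hu, 𝓜, hR, h𝓜⟩
    exact ⟨hu, ⟨𝓜, hR⟩, (inU_iff_inAleph 𝓛 I hε0 hε1 u ⟨𝓜, hR⟩).2 h𝓜⟩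

/-- Reading the conclusion of **Theorem M2** on the instance back in Setup's `ℝ≥0∞` terms: for a threshold `C ε₀ < 1`,
`m2Dec X ≤ C ε₀ ∧ m2Flux X ≤ (C ε₀)²` is literally `M2Dec ≤ C ε₀ ∧ M2Flux ≤ (C ε₀)²` for the concrete Setup terms of §13
(instance of the caveat in the module docstring; the same two-line proof serves M0, M1, M3–M5). [folklore] -/
theorem m2Concl_iff (K : Bootstrap.LesConstants) (h0 : 0 ≤ K.cM2 * c.ε₀) (h1 : K.cM2 * c.ε₀ < 1) (X : Sp c M Realized) :
    ((settingOf 𝓛 I).m2Dec X ≤ K.cM2 * c.toBootstrap.ε0 ∧ (settingOf 𝓛 I).m2Flux X ≤ (K.cM2 * c.toBootstrap.ε0) ^ 2) ↔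
    (X.1.M2Dec ≤ ENNReal.ofReal (K.cM2 * c.ε₀) ∧ X.1.M2Flux ≤ ENNReal.ofReal ((K.cM2 * c.ε₀) ^ 2)) := by
  have h1' : (K.cM2 * c.ε₀) ^ 2 < 1 := by nlinarith
  show (trunc X.1.M2Dec ≤ K.cM2 * c.ε₀ ∧ trunc X.1.M2Flux ≤ (K.cM2 * c.ε₀) ^ 2) ↔ _
  exact Iff.and (Bootstrap.trunc_le_iff h0 h1) (Bootstrap.trunc_le_iff (sq_nonneg _) h1')

/-- Hence the node `Bootstrap.ThmM2` on the instance, unfolded: under (3.4.11), BA-B, BA-D (Setup's predicates), the two displayed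
quantities of KS l.6695 (Setup §13) are `≤ C ε₀`, `≤ (C ε₀)²`. [cite: KlainermanSzeftel2021, TeX l.6695] -/
theorem thmM2_iff (K : Bootstrap.LesConstants) (hε0 : 0 ≤ c.ε) (hε1 : c.ε < 1) (h0 : 0 ≤ K.cM2 * c.ε₀)
    (h1 : K.cM2 * c.ε₀ < 1) :
    Bootstrap.ThmM2 K (settingOf 𝓛 I) ↔
      (Bootstrap.IDLWeak (settingOf 𝓛 I) → ∀ X : Sp c M Realized, X.1.BootstrapB → X.1.BootstrapD →
        X.1.M2Dec ≤ ENNReal.ofReal (K.cM2 * c.ε₀) ∧ X.1.M2Flux ≤ ENNReal.ofReal ((K.cM2 * c.ε₀) ^ 2)) := by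
  unfold Bootstrap.ThmM2
  refine forall_congr' fun _ => forall_congr' fun X => ?_
  rw [baB_iff 𝓛 I hε0 hε1 X, baD_iff 𝓛 I hε0 hε1 X, m2Concl_iff 𝓛 I K h0 h1 X]

end Consistency

variable (c M Realized)

/-- With PT data CHOSEN per realized spacetime (`P`; the construction of [KS] §9.2.3, l.23166–23260, is itself an input), the opaque `Inputs.ptNorm` / `idlPT`
have the concrete candidates `X ↦ (𝔖_k + ℜ_k).toReal`, `X ↦ (ℑ^{PT}_k).toReal`. [cite: KlainermanSzeftel2021, TeX l.23166–23260] -/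
def ptNormOf (P : ∀ X : Sp c M Realized, X.1.PTData) (X : Sp c M Realized) (k : ℕ) : ℝ := ((P X).Sk k + (P X).Rk k).toReal
/-- the real reading `X ↦ (ℑ^{PT}_k).toReal` of Setup's initial PT norm `IkPT` ([KS] l.24033–24035). [cite: KlainermanSzeftel2021, TeX l.24033–24035] -/
def idlPTOf (P : ∀ X : Sp c M Realized, X.1.PTData) (X : Sp c M Realized) (k : ℕ) : ℝ := ((P X).IkPT k).toReal

variable {c M Realized}

/-- the Main PT-Theorem's conclusion (Setup `MainPTConcl C`) gives the real bound `ptNormOf P X k ≤ C ε₀` for `k ≤ k_large + 7`, when `0 ≤ C ε₀` [folklore] -/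
theorem ptNormOf_le (P : ∀ X : Sp c M Realized, X.1.PTData) (X : Sp c M Realized) {C : ℝ} (hC : 0 ≤ C * c.ε₀)
    (h : (P X).MainPTConcl C) (k : ℕ) (hk : k ≤ c.kLarge + 7) : ptNormOf c M Realized P X k ≤ C * c.ε₀ :=
  ENNReal.toReal_le_of_le_ofReal hC (h k hk)


end Bridge

end Literature.Geometry.Lorentzian.KlainermanSzeftel2021

end
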